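import Mathlib
import HarnessLib
import Summits.HubbardSuperconductivity.HubbardSuperconductivity.Theorems.WeakCouplingBCSKlCertDOSQuadrature

/-!
# Route `WeakCouplingBCS` — support item `WcbcsKohnLuttingerB1g` (stmt-HubbardSuperconductivity-0158):
# cell chains, the `D₄` reduction `∫_{(-π,π]} w = 8 ∫₀^{π/4} w`, and the density-of-states mass as a `θ`-integral

Continuation of `WeakCouplingBCSKlCertDOSQuadrature.lean` (R2dCERT rung R2/T3, cell gate-hubbard-kl):

* `chainOK μq s l` / `endOf s l` / `lowerSum l` / `upperSum l` — a list of `DOSCell`s chained from `s`, its end point, and the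
  zero-order Riemann brackets; **`chain_bounds`**: `chainOK μq s l = true → lowerSum l ≤ ∫_s^{end} w_μ ≤ upperSum l`;
* `fermiPolarDOS_add_pi_div_two'`, `fermiPolarDOS_neg'` — the `D₄` symmetries of `w_μ = u/∂_tF` (from the tree's
  `bandFermiRadius_add_pi_div_two` / `bandFermiRadius_neg` and the explicit formula for `∂_tF`);
* **`integral_fermiPolarDOS_eq_eight_mul`** — `∫_{-π}^{π} w_μ = 8 ∫₀^{π/4} w_μ`;
* **`fermiCurveMeasure_univ_toReal_eq`** — `(σ_μ(ℝ²)).toReal = ∫_{-π}^{π} w_μ` (from the tree's `fermiCurveMeasure_univ`).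

Everything is proved; definitions are the checker's rational bookkeeping only. [folklore]
-/

noncomputable section

-- the tree's namespace `Summit.<Summit>.<Problem>.Theorems` repeats the summit name by design (D-0017)
set_option linter.dupNamespace false

namespace Summit.HubbardSuperconductivity.HubbardSuperconductivity.Theorems.KlCertQuad

open Real Set MeasureTheory intervalIntegral Literature.MathematicalPhysics.QuantumLattice

/-! ### Chains of cells -/

/-- The cells are consecutive starting at `s` and every cell passes its certificate. [folklore] -/
def chainOK (μq : ℚ) : ℚ → List DOSCell → Bool
  | _, [] => true
  | s, c :: l => decide (c.a = s) && c.ok μq && chainOK μq c.b l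

/-- The right end of a chain starting at `s`. [folklore] -/
def endOf : ℚ → List DOSCell → ℚ
  | s, [] => s
  | _, c :: l => endOf c.b l

/-- Outward rounding DOWN to the dyadic grid `2⁻³²` (keeps the Riemann sums short in the kernel). [folklore] -/
def dyDown (x : ℚ) : ℚ := (⌊x * 2 ^ 32⌋ : ℚ) / 2 ^ 32

/-- Outward rounding UP to the dyadic grid `2⁻³²`. [folklore] -/
def dyUp (x : ℚ) : ℚ := (⌈x * 2 ^ 32⌉ : ℚ) / 2 ^ 32

/-- `dyDown x ≤ x`. [folklore] -/
theorem dyDown_le (x : ℚ) : dyDown x ≤ x := by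
  rw [dyDown, div_le_iff₀ (by positivity)]
  exact Int.floor_le _

/-- `x ≤ dyUp x`. [folklore] -/
theorem le_dyUp (x : ℚ) : x ≤ dyUp x := by
  rw [dyUp, le_div_iff₀ (by positivity)]
  exact Int.le_ceil _

/-- The lower Riemann bracket `Σ (b - a) · ⌊wLo⌋₃₂`. [folklore] -/
def lowerSum : List DOSCell → ℚ
  | [] => 0
  | c :: l => (c.b - c.a) * dyDown c.wLo + lowerSum l

/-- The upper Riemann bracket `Σ (b - a) · ⌈wHi⌉₃₂`. [folklore] -/
def upperSum : List DOSCell → ℚ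
  | [] => 0
  | c :: l => (c.b - c.a) * dyUp c.wHi + upperSum l

section Chain

variable {μq : ℚ} (hμ₁ : -4 < ((μq : ℚ) : ℝ)) (hμ₂ : ((μq : ℚ) : ℝ) < 0)
include hμ₁ hμ₂

/-- `w_μ` is interval integrable on every interval (it is continuous). [folklore] -/
theorem intervalIntegrable_fermiPolarDOS (s t : ℝ) :
    IntervalIntegrable (fermiPolarDOS (μq : ℝ)) volume s t :=
  (continuous_fermiPolarDOS hμ₁ hμ₂).intervalIntegrable _ _

/-- One certified cell: `(b - a) · ⌊wLo⌋ ≤ ∫_a^b w_μ ≤ (b - a) · ⌈wHi⌉`. [folklore] -/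
theorem cell_bounds {c : DOSCell} (hc : c.ok μq = true) :
    (((c.b - c.a) * dyDown c.wLo : ℚ) : ℝ) ≤ ∫ θ in ((c.a : ℚ) : ℝ)..((c.b : ℚ) : ℝ), fermiPolarDOS (μq : ℝ) θ ∧
      ∫ θ in ((c.a : ℚ) : ℝ)..((c.b : ℚ) : ℝ), fermiPolarDOS (μq : ℝ) θ ≤ (((c.b - c.a) * dyUp c.wHi : ℚ) : ℝ) := by
  obtain ⟨⟨-, hab, -⟩, -⟩ := DOSCell.ok_spec hc
  have hab' : ((c.a : ℚ) : ℝ) ≤ c.b := by exact_mod_cast hab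
  have hba0 : (0 : ℝ) ≤ ((c.b : ℚ) : ℝ) - c.a := by linarith
  have hI := intervalIntegrable_fermiPolarDOS hμ₁ hμ₂ ((c.a : ℚ) : ℝ) ((c.b : ℚ) : ℝ)
  have hdn : ((dyDown c.wLo : ℚ) : ℝ) ≤ c.wLo := by exact_mod_cast dyDown_le _
  have hup : ((c.wHi : ℚ) : ℝ) ≤ dyUp c.wHi := by exact_mod_cast le_dyUp _
  constructor
  · have h := intervalIntegral.integral_mono_on hab' intervalIntegrable_const hI
      (fun θ hθ => (DOSCell.dos_mem hμ₁ hμ₂ hc hθ.1 hθ.2).1)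
    rw [intervalIntegral.integral_const, smul_eq_mul] at h
    push_cast
    nlinarith [mul_le_mul_of_nonneg_left hdn hba0]
  · have h := intervalIntegral.integral_mono_on hab' hI intervalIntegrable_const
      (fun θ hθ => (DOSCell.dos_mem hμ₁ hμ₂ hc hθ.1 hθ.2).2)
    rw [intervalIntegral.integral_const, smul_eq_mul] at h
    push_cast
    nlinarith [mul_le_mul_of_nonneg_left hup hba0]

/-- **Chains are sound**: `lowerSum l ≤ ∫_s^{endOf s l} w_μ ≤ upperSum l` for a certified chain from `s`. [folklore] -/
theorem chain_bounds : ∀ (l : List DOSCell) (s : ℚ), chainOK μq s l = true →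
    ((lowerSum l : ℚ) : ℝ) ≤ ∫ θ in ((s : ℚ) : ℝ)..((endOf s l : ℚ) : ℝ), fermiPolarDOS (μq : ℝ) θ ∧
      ∫ θ in ((s : ℚ) : ℝ)..((endOf s l : ℚ) : ℝ), fermiPolarDOS (μq : ℝ) θ ≤ ((upperSum l : ℚ) : ℝ)
  | [], s, _ => by simp [lowerSum, upperSum, endOf]
  | c :: l, s, h => by
    simp only [chainOK, Bool.and_eq_true, decide_eq_true_eq] at h
    obtain ⟨⟨hs, hc⟩, hl⟩ := h
    obtain ⟨ih₁, ih₂⟩ := chain_bounds l c.b hl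
    obtain ⟨hc₁, hc₂⟩ := cell_bounds hμ₁ hμ₂ hc
    rw [endOf, lowerSum, upperSum, ← hs]
    have hsplit := (intervalIntegral.integral_add_adjacent_intervals
      (intervalIntegrable_fermiPolarDOS hμ₁ hμ₂ ((c.a : ℚ) : ℝ) ((c.b : ℚ) : ℝ))
      (intervalIntegrable_fermiPolarDOS hμ₁ hμ₂ ((c.b : ℚ) : ℝ) ((endOf c.b l : ℚ) : ℝ))).symm
    rw [hsplit]
    push_cast at hc₁ hc₂ ⊢
    constructor <;> linarith

end Chain

/-! ### The `D₄` symmetries of the density of states -/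

/-- `∂_tF(θ + π/2, t) = ∂_tF(θ, t)`. [folklore] -/
theorem rayDispersionDt_add_pi_div_two (θ t : ℝ) : rayDispersionDt (θ + π / 2) t = rayDispersionDt θ t := by
  simp only [rayDispersionDt, Real.cos_add_pi_div_two, Real.sin_add_pi_div_two, mul_neg, Real.sin_neg, neg_mul,
    neg_neg]
  ring

/-- `∂_tF(-θ, t) = ∂_tF(θ, t)`. [folklore] -/
theorem rayDispersionDt_neg (θ t : ℝ) : rayDispersionDt (-θ) t = rayDispersionDt θ t := by
  simp only [rayDispersionDt, Real.cos_neg, Real.sin_neg, mul_neg, neg_mul, neg_neg]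

section Symm

variable {μ : ℝ} (hμ₁ : -4 < μ) (hμ₂ : μ < 0)
include hμ₁ hμ₂

/-- **Quarter-turn symmetry of the density of states**: `w_μ(θ + π/2) = w_μ(θ)`. [folklore] -/
theorem fermiPolarDOS_add_pi_div_two' (θ : ℝ) : fermiPolarDOS μ (θ + π / 2) = fermiPolarDOS μ θ := by
  rw [klpt_fermiPolarDOS_eq hμ₁ hμ₂, klpt_fermiPolarDOS_eq hμ₁ hμ₂, bandFermiRadius_add_pi_div_two hμ₁ hμ₂,
    rayDispersionDt_add_pi_div_two]

/-- **Reflection symmetry of the density of states**: `w_μ(-θ) = w_μ(θ)`. [folklore] -/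
theorem fermiPolarDOS_neg' (θ : ℝ) : fermiPolarDOS μ (-θ) = fermiPolarDOS μ θ := by
  rw [klpt_fermiPolarDOS_eq hμ₁ hμ₂, klpt_fermiPolarDOS_eq hμ₁ hμ₂, bandFermiRadius_neg hμ₁ hμ₂, rayDispersionDt_neg]

/-- `w_μ(π/2 - θ) = w_μ(θ)`. [folklore] -/
theorem fermiPolarDOS_pi_div_two_sub (θ : ℝ) : fermiPolarDOS μ (π / 2 - θ) = fermiPolarDOS μ θ := by
  rw [sub_eq_neg_add, fermiPolarDOS_add_pi_div_two' hμ₁ hμ₂, fermiPolarDOS_neg' hμ₁ hμ₂]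

/-- Shifting the integration interval by `π/2` does not change the integral. [folklore] -/
theorem integral_fermiPolarDOS_shift (s t : ℝ) :
    ∫ θ in s..t, fermiPolarDOS μ θ = ∫ θ in (s + π / 2)..(t + π / 2), fermiPolarDOS μ θ := by
  rw [← intervalIntegral.integral_comp_add_right (fun θ => fermiPolarDOS μ θ) (π / 2)]
  simp_rw [fermiPolarDOS_add_pi_div_two' hμ₁ hμ₂]

/-- **The `D₄` reduction**: `∫_{-π}^{π} w_μ = 8 ∫₀^{π/4} w_μ`. [folklore] -/
theorem integral_fermiPolarDOS_eq_eight_mul :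
    ∫ θ in (-π)..π, fermiPolarDOS μ θ = 8 * ∫ θ in (0 : ℝ)..(π / 4), fermiPolarDOS μ θ := by
  have hI : ∀ s t : ℝ, IntervalIntegrable (fermiPolarDOS μ) volume s t :=
    fun s t => (continuous_fermiPolarDOS hμ₁ hμ₂).intervalIntegrable _ _
  -- quarter period: every quarter integral equals `∫₀^{π/2}`
  have hq : ∀ s : ℝ, ∫ θ in s..(s + π / 2), fermiPolarDOS μ θ = ∫ θ in (s + π / 2)..(s + π / 2 + π / 2), fermiPolarDOS μ θ :=
    fun s => integral_fermiPolarDOS_shift hμ₁ hμ₂ _ _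
  have h1 : ∫ θ in (-π)..(-π + π / 2), fermiPolarDOS μ θ = ∫ θ in (0 : ℝ)..(π / 2), fermiPolarDOS μ θ := by
    rw [hq, hq]; congr 1 <;> ring
  have h2 : ∫ θ in (-π + π / 2)..0, fermiPolarDOS μ θ = ∫ θ in (0 : ℝ)..(π / 2), fermiPolarDOS μ θ := by
    have := hq (-π + π / 2)
    rw [show -π + π / 2 + π / 2 = (0 : ℝ) by ring, show (0 : ℝ) + π / 2 = π / 2 by ring] at this
    exact this
  have h3 : ∫ θ in (π / 2)..π, fermiPolarDOS μ θ = ∫ θ in (0 : ℝ)..(π / 2), fermiPolarDOS μ θ := by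
    have := hq 0
    rw [zero_add, show π / 2 + π / 2 = π by ring] at this
    exact this.symm
  -- the half quarter: `∫_{π/4}^{π/2} w = ∫₀^{π/4} w` by `θ ↦ π/2 - θ`
  have h4 : ∫ θ in (π / 4)..(π / 2), fermiPolarDOS μ θ = ∫ θ in (0 : ℝ)..(π / 4), fermiPolarDOS μ θ := by
    have := intervalIntegral.integral_comp_sub_left (fun θ => fermiPolarDOS μ θ) (π / 2) (a := 0) (b := π / 4)
    simp_rw [fermiPolarDOS_pi_div_two_sub hμ₁ hμ₂] at this
    rw [show π / 2 - π / 4 = π / 4 by ring, sub_zero] at this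
    exact this.symm
  have hhalf : ∫ θ in (0 : ℝ)..(π / 2), fermiPolarDOS μ θ = 2 * ∫ θ in (0 : ℝ)..(π / 4), fermiPolarDOS μ θ := by
    rw [← intervalIntegral.integral_add_adjacent_intervals (hI 0 (π / 4)) (hI (π / 4) (π / 2)), h4]; ring
  rw [← intervalIntegral.integral_add_adjacent_intervals (hI (-π) (-π + π / 2)) (hI (-π + π / 2) π),
    ← intervalIntegral.integral_add_adjacent_intervals (hI (-π + π / 2) 0) (hI 0 π),
    ← intervalIntegral.integral_add_adjacent_intervals (hI 0 (π / 2)) (hI (π / 2) π), h1, h2, h3, hhalf]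
  ring

/-- **The density-of-states mass as a `θ`-integral**: `(σ_μ(ℝ²)).toReal = ∫_{-π}^{π} w_μ(θ) dθ`. [folklore] -/
theorem fermiCurveMeasure_univ_toReal_eq :
    (fermiCurveMeasure (squareDispersion 1 0) μ univ).toReal = ∫ θ in (-π)..π, fermiPolarDOS μ θ := by
  rw [fermiCurveMeasure_univ hμ₁ hμ₂, intervalIntegral.integral_of_le (by linarith [Real.pi_pos]),
    ← MeasureTheory.ofReal_integral_eq_lintegral_ofReal, ENNReal.toReal_ofReal]
  · exact MeasureTheory.setIntegral_nonneg measurableSet_Ioc fun θ _ => (fermiPolarDOS_pos hμ₁ hμ₂ θ).le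
  · exact (continuous_fermiPolarDOS hμ₁ hμ₂).integrableOn_Ioc
  · exact Filter.Eventually.of_forall fun θ => (fermiPolarDOS_pos hμ₁ hμ₂ θ).le

/-- **Mass from a quarter-arc integral**: `(σ_μ(ℝ²)).toReal = 8 ∫₀^{π/4} w_μ`. [folklore] -/
theorem fermiCurveMeasure_univ_toReal_eq_eight_mul :
    (fermiCurveMeasure (squareDispersion 1 0) μ univ).toReal = 8 * ∫ θ in (0 : ℝ)..(π / 4), fermiPolarDOS μ θ := by
  rw [fermiCurveMeasure_univ_toReal_eq hμ₁ hμ₂, integral_fermiPolarDOS_eq_eight_mul hμ₁ hμ₂]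

/-- Monotonicity of `∫₀^t w_μ` in `t ≥ 0` (`w_μ > 0`). [folklore] -/
theorem integral_fermiPolarDOS_mono {s t : ℝ} (hs : 0 ≤ s) (hst : s ≤ t) :
    ∫ θ in (0 : ℝ)..s, fermiPolarDOS μ θ ≤ ∫ θ in (0 : ℝ)..t, fermiPolarDOS μ θ :=
  intervalIntegral.integral_mono_interval le_rfl hs hst
    (Filter.Eventually.of_forall fun θ => (fermiPolarDOS_pos hμ₁ hμ₂ θ).le)
    ((continuous_fermiPolarDOS hμ₁ hμ₂).intervalIntegrable _ _)

end Symm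

/-! ### Rational brackets of `π/4` -/

/-- A rational lower bound of `π/4`. [folklore] -/
def pi4Lo : ℚ := 785398 / 1000000
/-- A rational upper bound of `π/4`. [folklore] -/
def pi4Hi : ℚ := 7853985 / 10000000

/-- `pi4Lo < π/4`. [folklore] -/
theorem pi4Lo_lt : ((pi4Lo : ℚ) : ℝ) < π / 4 := by
  have := Real.pi_gt_d6; rw [pi4Lo]; push_cast; linarith
/-- `π/4 < pi4Hi`. [folklore] -/
theorem lt_pi4Hi : π / 4 < ((pi4Hi : ℚ) : ℝ) := by
  have := Real.pi_lt_d6; rw [pi4Hi]; push_cast; linarith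

/-- **The assembled certificate for the quarter-arc integral.**  Two certified chains from `0` — a SHORT one ending at
`e₁ ≤ π/4` and a LONG one ending at `e₂ ≥ π/4` — enclose `∫₀^{π/4} w_μ` between `lowerSum short` and `upperSum long`
(positivity of `w_μ` moves the irrational end point `π/4` onto the rational ones). [folklore] -/
theorem quarter_integral_mem {μq : ℚ} (hμ₁ : -4 < ((μq : ℚ) : ℝ)) (hμ₂ : ((μq : ℚ) : ℝ) < 0)
    {short long : List DOSCell} (hshort : chainOK μq 0 short = true) (hlong : chainOK μq 0 long = true)
    (he₁ : endOf 0 short ≤ pi4Lo) (he₂ : pi4Hi ≤ endOf 0 long) :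
    ((lowerSum short : ℚ) : ℝ) ≤ ∫ θ in (0 : ℝ)..(π / 4), fermiPolarDOS (μq : ℝ) θ ∧
      ∫ θ in (0 : ℝ)..(π / 4), fermiPolarDOS (μq : ℝ) θ ≤ ((upperSum long : ℚ) : ℝ) := by
  obtain ⟨h₁, -⟩ := chain_bounds hμ₁ hμ₂ short 0 hshort
  obtain ⟨-, h₂⟩ := chain_bounds hμ₁ hμ₂ long 0 hlong
  push_cast at h₁ h₂
  have he₁' : ((endOf 0 short : ℚ) : ℝ) ≤ π / 4 := (show ((endOf 0 short : ℚ) : ℝ) ≤ pi4Lo by exact_mod_cast he₁).trans pi4Lo_lt.le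
  have he₂' : π / 4 ≤ ((endOf 0 long : ℚ) : ℝ) := lt_pi4Hi.le.trans (by exact_mod_cast he₂)
  -- end points of certified chains from `0` are `≥ 0`
  have hend : ∀ (l : List DOSCell) (s : ℚ), chainOK μq s l = true → s ≤ endOf s l := by
    intro l
    induction l with
    | nil => intro s _; simp [endOf]
    | cons c l ih =>
      intro s h
      simp only [chainOK, Bool.and_eq_true, decide_eq_true_eq] at h
      obtain ⟨⟨hs, hc⟩, hl⟩ := h
      obtain ⟨⟨-, hab, -⟩, -⟩ := DOSCell.ok_spec hc
      rw [endOf, ← hs]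
      exact hab.trans (ih c.b hl)
  have h0₁ : (0 : ℝ) ≤ ((endOf 0 short : ℚ) : ℝ) := by exact_mod_cast hend short 0 hshort
  constructor
  · exact h₁.trans (integral_fermiPolarDOS_mono hμ₁ hμ₂ h0₁ he₁')
  · exact (integral_fermiPolarDOS_mono hμ₁ hμ₂ (by linarith [Real.pi_pos]) he₂').trans h₂

end Summit.HubbardSuperconductivity.HubbardSuperconductivity.Theorems.KlCertQuad

end
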